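import Mathlib.MeasureTheory.Integral.IntervalIntegral.Periodic
import Mathlib.MeasureTheory.Integral.IntervalIntegral.FundThmCalculus
import Summits.AnomalousDissipation.AnomalousDissipation.Theorems.SawtoothPulseCascadeK1LocalisedCascadeStripCutoff

/-!
# K1loc, line `Spectral` / SeqCone — helper: THE AFFINE-IZED SHEAR PROFILE `Ũ` (exactly linear on the flat strips)

Helper file of the prover lane on the crux `K1LocalisedCascade` (stmt-AnomalousDissipation-19491), route
`SawtoothPulseCascade` (memo v6 §2b).  The un-gauging bricks `…SlotMultiplierData` / `…SlotFlatLeibniz` need a shear profile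
whose slope is EXACTLY constant on an open set carrying the strip cut-offs, while the cascade profile `U_j` (a Gaussian
mollification) is nowhere affine.  Repair: factor the shear as `Φ_{γU} = Φ_{γŨ} ∘ Φ_{γ(U−Ũ)}` with `Ũ` affine on the strips and
`U − Ũ` uniformly small.  Construction (for any `U` with slope function `V = U′`, `|V| ≤ 1`, and a width `δ`): with the
plateau cut-offs `G^±(y) = smoothTransition((±V(y) − (1−2δ))/δ)` of `…StripCutoff` (equal to `1` where `±V ≥ 1 − δ`),
the slope correction `D = (1 − V)G⁺ + (−1 − V)G⁻` and its mean `c = ∫₀¹ D`,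
  `Ũ(y) = U(y) + ∫₀ʸ D − c·y`.
Then `Ũ′ = V + D − c` equals `1 − c` where `V ≥ 1 − δ` and `−1 − c` where `V ≤ −(1 − δ)` (EXACTLY), `|D| ≤ 2δ`,
`|c| ≤ 2δ`, `|Ũ′ − V| ≤ 4δ`, `|Ũ − U| ≤ 4δ`, and `Ũ` is smooth and `1`-periodic (a `ShearProfile`).  (For the cascade profile the
half-period antisymmetry `U_j′(y + 1/(2N_j)) = −U_j′(y)` gives `c = 0`; not used here.)  No definitions; no statement about the
stub.
[cite: ElgindiLissMattingly2025, §1 (the piecewise-linear shears H_α, V_α which Ũ restores on the flat strips)] [problem: turb]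
-/

-- `Summit.<Summit>.<Problem>`: single-conjunct summit, the duplicate namespace segment is deliberate.
set_option linter.dupNamespace false

noncomputable section

namespace Summit.AnomalousDissipation.AnomalousDissipation.Theorems.SawtoothPulseCascade.K1Cutoff

open Set Filter Topology Real MeasureTheory intervalIntegral
open scoped ContDiff

/-! ## The slope correction `D = (1 − V)G⁺ + (−1 − V)G⁻` -/

/-- On the deep `+` flat (`V ≥ 1 − δ`, with `0 < δ ≤ 2/3`) the correction is `1 − V` (so `V + D = 1` exactly).
[cite: ElgindiLissMattingly2025, §1 (slope +1 strips)] -/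
theorem slopeCorr_eq_of_ge {V : ℝ → ℝ} {δ : ℝ} (hδ : 0 < δ) (hδ1 : δ ≤ 2 / 3) {y : ℝ} (hy : 1 - δ ≤ V y) :
    (1 - V y) * smoothTransition ((V y - (1 - 2 * δ)) / δ) +
        (-1 - V y) * smoothTransition ((-V y - (1 - 2 * δ)) / δ) = 1 - V y := by
  rw [cutoff_eq_one hδ hy, mul_one]
  have h0 : smoothTransition ((-V y - (1 - 2 * δ)) / δ) = 0 :=
    Real.smoothTransition.zero_of_nonpos (div_nonpos_of_nonpos_of_nonneg (by linarith) hδ.le)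
  rw [h0, mul_zero, add_zero]

/-- On the deep `−` flat (`V ≤ −(1 − δ)`) the correction is `−1 − V` (so `V + D = −1` exactly).
[cite: ElgindiLissMattingly2025, §1 (slope −1 strips)] -/
theorem slopeCorr_eq_of_le {V : ℝ → ℝ} {δ : ℝ} (hδ : 0 < δ) (hδ1 : δ ≤ 2 / 3) {y : ℝ} (hy : V y ≤ -(1 - δ)) :
    (1 - V y) * smoothTransition ((V y - (1 - 2 * δ)) / δ) +
        (-1 - V y) * smoothTransition ((-V y - (1 - 2 * δ)) / δ) = -1 - V y := by
  rw [cutoff_eq_one (V := fun y => -V y) hδ (by show 1 - δ ≤ -V y; linarith), mul_one]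
  have h0 : smoothTransition ((V y - (1 - 2 * δ)) / δ) = 0 :=
    Real.smoothTransition.zero_of_nonpos (div_nonpos_of_nonpos_of_nonneg (by linarith) hδ.le)
  rw [h0, mul_zero, zero_add]

/-- The correction is uniformly small: `|D| ≤ 2δ` when `|V| ≤ 1` and `0 < δ ≤ 1/2`. [folklore] -/
theorem abs_slopeCorr_le {V : ℝ → ℝ} {δ : ℝ} (hδ : 0 < δ) (hδ2 : δ ≤ 1 / 2) (hV : ∀ y, |V y| ≤ 1) (y : ℝ) :
    |(1 - V y) * smoothTransition ((V y - (1 - 2 * δ)) / δ) +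
        (-1 - V y) * smoothTransition ((-V y - (1 - 2 * δ)) / δ)| ≤ 2 * δ := by
  have hV1 := (abs_le.mp (hV y))
  have hdis := cutoff_mul_cutoff_neg_eq_zero (V := V) hδ hδ2 y
  rcases mul_eq_zero.mp hdis with h0 | h0
  · rw [h0, mul_zero, zero_add, abs_mul, abs_of_nonneg (cutoff_nonneg (fun y => -V y) δ y)]
    by_cases hm : smoothTransition ((-V y - (1 - 2 * δ)) / δ) = 0
    · rw [hm, mul_zero]; linarith
    · have h1 : 1 - 2 * δ < -V y := lt_of_cutoff_ne_zero (V := fun y => -V y) hδ hm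
      calc |(-1 - V y)| * smoothTransition ((-V y - (1 - 2 * δ)) / δ) ≤ |(-1 - V y)| * 1 :=
            mul_le_mul_of_nonneg_left (cutoff_le_one (fun y => -V y) δ y) (abs_nonneg _)
        _ ≤ 2 * δ := by rw [mul_one, abs_le]; constructor <;> linarith
  · rw [h0, mul_zero, add_zero, abs_mul, abs_of_nonneg (cutoff_nonneg V δ y)]
    by_cases hp : smoothTransition ((V y - (1 - 2 * δ)) / δ) = 0
    · rw [hp, mul_zero]; linarith
    · have h1 := lt_of_cutoff_ne_zero hδ hp
      calc |(1 - V y)| * smoothTransition ((V y - (1 - 2 * δ)) / δ) ≤ |(1 - V y)| * 1 :=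
            mul_le_mul_of_nonneg_left (cutoff_le_one V δ y) (abs_nonneg _)
        _ ≤ 2 * δ := by rw [mul_one, abs_le]; constructor <;> linarith

/-- The correction is smooth when `V` is. [folklore] -/
theorem contDiff_slopeCorr {V : ℝ → ℝ} (hV : ContDiff ℝ ∞ V) (δ : ℝ) :
    ContDiff ℝ ∞ (fun y => (1 - V y) * smoothTransition ((V y - (1 - 2 * δ)) / δ) +
        (-1 - V y) * smoothTransition ((-V y - (1 - 2 * δ)) / δ)) :=
  ((contDiff_const.sub hV).mul (contDiff_cutoff hV δ)).add
    ((contDiff_const.sub hV).mul (contDiff_cutoff (V := fun y => -V y) hV.neg δ))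

/-- The correction is `1`-periodic when `V` is. [folklore] -/
theorem periodic_slopeCorr {V : ℝ → ℝ} (hV : Function.Periodic V 1) (δ : ℝ) :
    Function.Periodic (fun y => (1 - V y) * smoothTransition ((V y - (1 - 2 * δ)) / δ) +
        (-1 - V y) * smoothTransition ((-V y - (1 - 2 * δ)) / δ)) 1 := fun y => by
  simp only [hV y]

/-! ## The affine-ized profile `Ũ = U + ∫₀ D − c·id` (abstract correction `D`) -/

/-- **Derivative of `Ũ`**: for a continuous correction `D` and `U′ = V`, `Ũ′(y) = V(y) + D(y) − c`. [folklore] -/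
theorem hasDerivAt_affinize {U V D : ℝ → ℝ} (hUV : ∀ y, HasDerivAt U (V y) y) (hD : Continuous D) (c y : ℝ) :
    HasDerivAt (fun y => U y + (∫ t in (0 : ℝ)..y, D t) - c * y) (V y + D y - c) y := by
  have h1 := (hD.integral_hasStrictDerivAt 0 y).hasDerivAt
  have h2 : HasDerivAt (fun y => c * y) c y := by simpa using (hasDerivAt_id y).const_mul c
  exact ((hUV y).add h1).sub h2

/-- **Exact slopes of `Ũ` on the flats** (with `D` the explicit correction): `Ũ′ = 1 − c` where `V ≥ 1 − δ`.
[cite: ElgindiLissMattingly2025, §1 (slope +1 strips)] -/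
theorem hasDerivAt_affinize_of_ge {U V : ℝ → ℝ} {δ : ℝ} (hδ : 0 < δ) (hδ1 : δ ≤ 2 / 3)
    (hUV : ∀ y, HasDerivAt U (V y) y) (hVc : Continuous V) (c : ℝ) {y : ℝ} (hy : 1 - δ ≤ V y) :
    HasDerivAt (fun y => U y + (∫ t in (0 : ℝ)..y, ((1 - V t) * smoothTransition ((V t - (1 - 2 * δ)) / δ) +
        (-1 - V t) * smoothTransition ((-V t - (1 - 2 * δ)) / δ))) - c * y) (1 - c) y := by
  have hD : Continuous (fun t => (1 - V t) * smoothTransition ((V t - (1 - 2 * δ)) / δ) +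
      (-1 - V t) * smoothTransition ((-V t - (1 - 2 * δ)) / δ)) := by
    have hs := Real.smoothTransition.continuous
    exact ((continuous_const.sub hVc).mul (hs.comp ((hVc.sub continuous_const).div_const _))).add
      ((continuous_const.sub hVc).mul (hs.comp ((hVc.neg.sub continuous_const).div_const _)))
  have h := hasDerivAt_affinize hUV hD c y
  rwa [slopeCorr_eq_of_ge hδ hδ1 hy, show V y + (1 - V y) - c = 1 - c by ring] at h

/-- **Exact slopes of `Ũ` on the flats**: `Ũ′ = −1 − c` where `V ≤ −(1 − δ)`.
[cite: ElgindiLissMattingly2025, §1 (slope −1 strips)] -/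
theorem hasDerivAt_affinize_of_le {U V : ℝ → ℝ} {δ : ℝ} (hδ : 0 < δ) (hδ1 : δ ≤ 2 / 3)
    (hUV : ∀ y, HasDerivAt U (V y) y) (hVc : Continuous V) (c : ℝ) {y : ℝ} (hy : V y ≤ -(1 - δ)) :
    HasDerivAt (fun y => U y + (∫ t in (0 : ℝ)..y, ((1 - V t) * smoothTransition ((V t - (1 - 2 * δ)) / δ) +
        (-1 - V t) * smoothTransition ((-V t - (1 - 2 * δ)) / δ))) - c * y) (-1 - c) y := by
  have hD : Continuous (fun t => (1 - V t) * smoothTransition ((V t - (1 - 2 * δ)) / δ) +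
      (-1 - V t) * smoothTransition ((-V t - (1 - 2 * δ)) / δ)) := by
    have hs := Real.smoothTransition.continuous
    exact ((continuous_const.sub hVc).mul (hs.comp ((hVc.sub continuous_const).div_const _))).add
      ((continuous_const.sub hVc).mul (hs.comp ((hVc.neg.sub continuous_const).div_const _)))
  have h := hasDerivAt_affinize hUV hD c y
  rwa [slopeCorr_eq_of_le hδ hδ1 hy, show V y + (-1 - V y) - c = -1 - c by ring] at h

/-- **`Ũ` is `1`-periodic** when `U` and `D` are and `c = ∫₀¹ D` (the linear term removes the mean of `D`). [folklore] -/
theorem periodic_affinize {U D : ℝ → ℝ} (hU : Function.Periodic U 1) (hDp : Function.Periodic D 1) (hD : Continuous D) :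
    Function.Periodic (fun y => U y + (∫ t in (0 : ℝ)..y, D t) - (∫ t in (0 : ℝ)..1, D t) * y) 1 := by
  intro y
  have hint : ∀ a b : ℝ, IntervalIntegrable D volume a b := fun a b => hD.intervalIntegrable a b
  have hsplit : ∫ t in (0 : ℝ)..(y + 1), D t = (∫ t in (0 : ℝ)..y, D t) + ∫ t in y..(y + 1), D t :=
    (integral_add_adjacent_intervals (hint 0 y) (hint y (y + 1))).symm
  have hper : ∫ t in y..(y + 1), D t = ∫ t in (0 : ℝ)..1, D t := by
    have := hDp.intervalIntegral_add_eq y 0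
    rwa [zero_add] at this
  simp only [hU y, hsplit, hper]
  ring

/-- **`Ũ` is smooth** when `U′ = V` with `V` and `D` smooth. [folklore] -/
theorem contDiff_affinize {U V D : ℝ → ℝ} (hUV : ∀ y, HasDerivAt U (V y) y)
    (hV : ContDiff ℝ ∞ V) (hD : ContDiff ℝ ∞ D) (c : ℝ) :
    ContDiff ℝ ∞ (fun y => U y + (∫ t in (0 : ℝ)..y, D t) - c * y) := by
  have hderiv : deriv (fun y => U y + (∫ t in (0 : ℝ)..y, D t) - c * y) = fun y => V y + D y - c := by
    funext y; exact (hasDerivAt_affinize hUV hD.continuous c y).deriv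
  refine contDiff_infty_iff_deriv.mpr ⟨fun y => (hasDerivAt_affinize hUV hD.continuous c y).differentiableAt, ?_⟩
  rw [hderiv]
  exact (hV.add hD).sub contDiff_const

/-- **Size of the mean**: `|∫₀¹ D| ≤ M` if `|D| ≤ M`. [folklore] -/
theorem abs_integral_le_of_abs_le {D : ℝ → ℝ} {M : ℝ} (hM : ∀ t, |D t| ≤ M) : |∫ t in (0 : ℝ)..1, D t| ≤ M := by
  have h := norm_integral_le_of_norm_le_const (a := (0 : ℝ)) (b := 1) (f := D) (C := M) fun t _ => by
    rw [Real.norm_eq_abs]; exact hM t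
  rw [Real.norm_eq_abs, sub_zero, abs_one, mul_one] at h
  exact h

/-- **`Ũ′` stays close to `V`**: `|Ũ′ − V| ≤ 2M` if `|D| ≤ M` and `c = ∫₀¹ D`. [folklore] -/
theorem abs_deriv_affinize_sub_le {U V D : ℝ → ℝ} (hUV : ∀ y, HasDerivAt U (V y) y) (hD : Continuous D) {M : ℝ}
    (hM : ∀ t, |D t| ≤ M) (y : ℝ) :
    |deriv (fun y => U y + (∫ t in (0 : ℝ)..y, D t) - (∫ t in (0 : ℝ)..1, D t) * y) y - V y| ≤ 2 * M := by
  rw [(hasDerivAt_affinize hUV hD _ y).deriv, show V y + D y - (∫ t in (0 : ℝ)..1, D t) - V y =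
    D y - ∫ t in (0 : ℝ)..1, D t by ring]
  have h1 := hM y
  have h2 := abs_integral_le_of_abs_le hM
  exact (abs_sub _ _).trans (by linarith)

/-- **`Ũ` stays close to `U`**: `|Ũ − U| ≤ 2M` if `|D| ≤ M` with `D` continuous and `1`-periodic
(on `[0,1]` directly; elsewhere by periodicity of `Ũ − U = ∫₀D − c·id`). [folklore] -/
theorem abs_affinize_sub_le {U D : ℝ → ℝ} (hDp : Function.Periodic D 1)
    (hD : Continuous D) {M : ℝ} (hM : ∀ t, |D t| ≤ M) (y : ℝ) :
    |(U y + (∫ t in (0 : ℝ)..y, D t) - (∫ t in (0 : ℝ)..1, D t) * y) - U y| ≤ 2 * M := by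
  have hM0 : 0 ≤ M := (abs_nonneg _).trans (hM 0)
  -- the difference `E(y) = ∫₀ʸ D − c y` is `1`-periodic
  have hE : Function.Periodic (fun y => (∫ t in (0 : ℝ)..y, D t) - (∫ t in (0 : ℝ)..1, D t) * y) 1 := by
    have h := periodic_affinize (U := fun _ => (0 : ℝ)) (fun _ => rfl) hDp hD
    intro z
    have := h z
    simpa using this
  -- reduce to `y ∈ [0,1)`
  have hz0 : 0 ≤ Int.fract y := Int.fract_nonneg y
  have hz1 : Int.fract y < 1 := Int.fract_lt_one y
  have hEy : (∫ t in (0 : ℝ)..y, D t) - (∫ t in (0 : ℝ)..1, D t) * y =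
      (∫ t in (0 : ℝ)..(Int.fract y), D t) - (∫ t in (0 : ℝ)..1, D t) * Int.fract y := by
    have hper := (hE.int_mul (Int.floor y)) (Int.fract y)
    simp only [mul_one, Int.fract_add_floor] at hper
    exact hper
  set z := Int.fract y with hz
  rw [show (U y + (∫ t in (0 : ℝ)..y, D t) - (∫ t in (0 : ℝ)..1, D t) * y) - U y =
    (∫ t in (0 : ℝ)..y, D t) - (∫ t in (0 : ℝ)..1, D t) * y by ring, hEy]
  have h1 : |∫ t in (0 : ℝ)..z, D t| ≤ M * z := by
    have h := norm_integral_le_of_norm_le_const (a := (0 : ℝ)) (b := z) (f := D) (C := M) fun t _ => by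
      rw [Real.norm_eq_abs]; exact hM t
    rw [Real.norm_eq_abs, sub_zero, abs_of_nonneg hz0] at h
    exact h
  have h2 : |(∫ t in (0 : ℝ)..1, D t) * z| ≤ M * z := by
    rw [abs_mul, abs_of_nonneg hz0]
    exact mul_le_mul_of_nonneg_right (abs_integral_le_of_abs_le hM) hz0
  calc |(∫ t in (0 : ℝ)..z, D t) - (∫ t in (0 : ℝ)..1, D t) * z|
      ≤ |∫ t in (0 : ℝ)..z, D t| + |(∫ t in (0 : ℝ)..1, D t) * z| := abs_sub _ _
    _ ≤ M * z + M * z := add_le_add h1 h2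
    _ ≤ 2 * M := by nlinarith

end Summit.AnomalousDissipation.AnomalousDissipation.Theorems.SawtoothPulseCascade.K1Cutoff
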